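import Mathlib
import Summits.Ventures.PercRepro2.Defs
import Summits.Ventures.PercRepro2.Graph
import Summits.Ventures.PercRepro2.OneColourSwitch
import Summits.Ventures.PercRepro2.RegionHubSign
import Summits.Ventures.PercRepro2.SideSwitch
import Summits.Ventures.PercRepro2.TermSwitchDefs
import Summits.Ventures.PercRepro2.M9NoPocketDefs
import Summits.Ventures.PercRepro2.M9PsiOneDefs
import Summits.Ventures.PercRepro2.M9PsiOneWorlds
import Summits.Ventures.PercRepro2.M9PsiTwoDefs
import Summits.Ventures.PercRepro2.M9PsiTwoWorlds

/-!
# The second partner `Ψ₂ ω` does not increase `σ_pq` (blind cell PercRepro2, p3 g34,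
2026-08-29; `proofs/P3-REST2.md` §1, claim (iii))

For an `EX` colouring `ω`: a `Y`-path `p → q` of `Ψ₂ ω` avoids the `Y`-world of `Ψ₂ ω`, so it
lives in the outside and the unflipped `W`-core, where `Ψ₂` keeps every edge — it is a `Y`-path
of `ω` (`conn_of_conn_psiTwo`); a `W`-path `p → q` of `ω` avoids the `W`-world of `ω`, so it
lives in the outside and the `Y`-core, where `Ψ₂` keeps every edge — it is a `W`-path of `Ψ₂ ω`
(`conn_compl_psiTwo_of_conn_compl`).  Hence **`σ_pq(Ψ₂ ω) ≤ σ_pq(ω)`** (`sigma_psiTwo_pq_le`).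
Own work; std axioms.
-/

namespace Summit.Ventures.PercRepro2

namespace NoPocket

open Finset Classical RegionHub OneColourSwitch SideSwitch TermSwitch

variable {V : Type*} {E : Type*}

section Sigma

variable {ends : E → Sym2 V} {p q r s d : V} {ω : Config E}

variable (h : IsEX ends p q r s d ω)
include h

/-- `p` is outside both worlds of `ω`. -/
lemma p_mem_Outside : p ∈ Outside ends r s ω := by
  obtain ⟨⟨hpr, hps, _, _⟩, ⟨hpr', hps', _, _⟩⟩ := h.sep
  refine ⟨fun hp => ?_, fun hp => ?_⟩
  · rcases mem_K2_iff.1 hp with hc | hc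
    · exact hpr (conn_symm hc)
    · exact hps (conn_symm hc)
  · rcases mem_M2_iff.1 hp with hc | hc
    · exact hpr' (conn_symm hc)
    · exact hps' (conn_symm hc)

/-- `q` is outside both worlds of `ω`. -/
lemma q_mem_Outside : q ∈ Outside ends r s ω := by
  obtain ⟨⟨_, _, hqr, hqs⟩, ⟨_, _, hqr', hqs'⟩⟩ := h.sep
  refine ⟨fun hq => ?_, fun hq => ?_⟩
  · rcases mem_K2_iff.1 hq with hc | hc
    · exact hqr (conn_symm hc)
    · exact hqs (conn_symm hc)
  · rcases mem_M2_iff.1 hq with hc | hc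
    · exact hqr' (conn_symm hc)
    · exact hqs' (conn_symm hc)

omit h in
/-- An outside vertex is not flipped. -/
lemma out_not_mem_flipSetW {x : V} (hx : x ∈ Outside ends r s ω) : x ∉ flipSetW ends r s d ω :=
  fun hF => hx.2 (flipSetW_subset_Mcore hF).1

/-- A `Y`-core vertex is not flipped. -/
lemma Kcore_not_mem_flipSetW {x : V} (hx : x ∈ Kcore ends r s d ω) :
    x ∉ flipSetW ends r s d ω :=
  fun hF => not_mem_Mcore_of_mem_Kcore h.done hx (flipSetW_subset_Mcore hF)

/-- **A `Y`-connection of `Ψ₂ ω` from `p` transfers back to `ω`**: the set of vertices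
`Y`-connected to `p` in `ω` that are outside or unflipped `W`-core vertices is closed under the
open edges of `Ψ₂ ω`. -/
theorem conn_of_conn_psiTwo {u : V} (hc : Conn ends (psiTwo ends r s d ω) p u) :
    Conn ends ω p u := by
  have key : u ∈ {z | Conn ends ω p z ∧ (z ∈ Outside ends r s ω ∨
      (z ∈ Mcore ends r s d ω ∧ z ∉ flipSetW ends r s d ω))} := by
    refine mem_of_conn_of_closed (ends := ends) (ω := psiTwo ends r s d ω) ?_
      ⟨conn_refl _ _ _, Or.inl (p_mem_Outside h)⟩ hc
    intro x hx y hxy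
    obtain ⟨hne, e, he, hends⟩ := openGraph_adj.1 hxy
    obtain ⟨hxc, hxO | ⟨hxM, hxF⟩⟩ := hx
    · -- `x` outside
      rcases vertex_cases (ends := ends) (r := r) (s := s) (d := d) (ω := ω) y with
        hy | hy | hy | hyK | hyM | hyO
      · exact (no_edge_out_term h hxO (Or.inl hy) (ends_swap hends)).elim
      · exact (no_edge_out_term h hxO (Or.inr hy) (ends_swap hends)).elim
      · exact (no_edge_d_out h hxO (ends_swap (hy ▸ hends))).elim
      · exfalso
        rw [psiTwo_out h hxO (Kcore_not_mem_flipSetW h hyK) hends,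
          edge_Kcore_out hyK hxO (ends_swap hends)] at he
        exact Bool.false_ne_true he
      · by_cases hyF : y ∈ flipSetW ends r s d ω
        · exfalso
          rw [psiTwo_flip_out_eq_false h hyF hxO (ends_swap hends)] at he
          exact Bool.false_ne_true he
        · refine ⟨conn_trans hxc (conn_of_openAdj ⟨e, ?_, hends⟩), Or.inr ⟨hyM, hyF⟩⟩
          rw [← psiTwo_out h hxO hyF hends]; exact he
      · refine ⟨conn_trans hxc (conn_of_openAdj ⟨e, ?_, hends⟩), Or.inl hyO⟩
        rw [← psiTwo_out h hxO (out_not_mem_flipSetW hyO) hends]; exact he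
    · -- `x` an unflipped `W`-core vertex: every edge at `x` is kept
      have hkept : psiTwo ends r s d ω e = ω e := psiTwo_Mcore_kept h hxM hxF hends
      rcases vertex_cases (ends := ends) (r := r) (s := s) (d := d) (ω := ω) y with
        hy | hy | hy | hyK | hyM | hyO
      · exfalso
        rw [hkept, edge_Mcore_term h hxM (Or.inl hy) hends] at he
        exact Bool.false_ne_true he
      · exfalso
        rw [hkept, edge_Mcore_term h hxM (Or.inr hy) hends] at he
        exact Bool.false_ne_true he
      · exact (hxF (mem_flipSetW_of_adj_d hxM (hy ▸ hends))).elim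
      · exact (no_edge_core_core h hyK hxM (ends_swap hends)).elim
      · refine ⟨conn_trans hxc (conn_of_openAdj ⟨e, ?_, hends⟩), Or.inr ⟨hyM, ?_⟩⟩
        · rw [← hkept]; exact he
        · exact fun hyF => hxF (mem_flipSetW_of_edge' hyF hxM hends)
      · refine ⟨conn_trans hxc (conn_of_openAdj ⟨e, ?_, hends⟩), Or.inl hyO⟩
        rw [← hkept]; exact he
  exact key.1

/-- **A `W`-connection of `ω` from `p` transfers to `Ψ₂ ω`**: the set of vertices
`W`-connected to `p` in `Ψ₂ ω` that are outside or `Y`-core vertices is closed under the closed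
edges of `ω`. -/
theorem conn_compl_psiTwo_of_conn_compl {u : V}
    (hc : Conn ends (OneColourSwitch.compl ω) p u) :
    Conn ends (OneColourSwitch.compl (psiTwo ends r s d ω)) p u := by
  have key : u ∈ {z | Conn ends (OneColourSwitch.compl (psiTwo ends r s d ω)) p z ∧
      (z ∈ Outside ends r s ω ∨ z ∈ Kcore ends r s d ω)} := by
    refine mem_of_conn_of_closed (ends := ends) (ω := OneColourSwitch.compl ω) ?_
      ⟨conn_refl _ _ _, Or.inl (p_mem_Outside h)⟩ hc
    intro x hx y hxy
    obtain ⟨hne, e, he, hends⟩ := openGraph_adj.1 hxy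
    have hω : ω e = false := by simpa [OneColourSwitch.compl] using he
    obtain ⟨hxc, hxO | hxK⟩ := hx
    · -- `x` outside
      rcases vertex_cases (ends := ends) (r := r) (s := s) (d := d) (ω := ω) y with
        hy | hy | hy | hyK | hyM | hyO
      · exact (no_edge_out_term h hxO (Or.inl hy) (ends_swap hends)).elim
      · exact (no_edge_out_term h hxO (Or.inr hy) (ends_swap hends)).elim
      · exact (no_edge_d_out h hxO (ends_swap (hy ▸ hends))).elim
      · refine ⟨conn_trans hxc (conn_of_openAdj ⟨e, ?_, hends⟩), Or.inr hyK⟩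
        show (!psiTwo ends r s d ω e) = true
        rw [psiTwo_out h hxO (Kcore_not_mem_flipSetW h hyK) hends, hω]; rfl
      · exfalso
        rw [edge_Mcore_out hyM hxO (ends_swap hends)] at hω
        exact Bool.false_ne_true hω.symm
      · refine ⟨conn_trans hxc (conn_of_openAdj ⟨e, ?_, hends⟩), Or.inl hyO⟩
        show (!psiTwo ends r s d ω e) = true
        rw [psiTwo_out h hxO (out_not_mem_flipSetW hyO) hends, hω]; rfl
    · -- `x` a `Y`-core vertex: every edge at `x` is kept
      have hkept : psiTwo ends r s d ω e = ω e := psiTwo_Kcore h hxK hends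
      rcases vertex_cases (ends := ends) (r := r) (s := s) (d := d) (ω := ω) y with
        hy | hy | hy | hyK | hyM | hyO
      · exfalso
        rw [edge_Kcore_term h hxK (Or.inl hy) hends] at hω
        exact Bool.false_ne_true hω.symm
      · exfalso
        rw [edge_Kcore_term h hxK (Or.inr hy) hends] at hω
        exact Bool.false_ne_true hω.symm
      · exfalso
        rw [edge_Kcore_d h hxK (hy ▸ hends)] at hω
        exact Bool.false_ne_true hω.symm
      · refine ⟨conn_trans hxc (conn_of_openAdj ⟨e, ?_, hends⟩), Or.inr hyK⟩
        show (!psiTwo ends r s d ω e) = true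
        rw [hkept, hω]; rfl
      · exact (no_edge_core_core h hxK hyM hends).elim
      · refine ⟨conn_trans hxc (conn_of_openAdj ⟨e, ?_, hends⟩), Or.inl hyO⟩
        show (!psiTwo ends r s d ω e) = true
        rw [hkept, hω]; rfl
  exact key.1

/-- **`σ_pq(Ψ₂ ω) ≤ σ_pq(ω)`.** -/
theorem sigma_psiTwo_pq_le : sigma ends (psiTwo ends r s d ω) p q ≤ sigma ends ω p q := by
  unfold sigma
  have h1 : (if Conn ends (psiTwo ends r s d ω) p q then (1 : ℤ) else 0) ≤
      (if Conn ends ω p q then 1 else 0) := by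
    by_cases hc : Conn ends (psiTwo ends r s d ω) p q
    · rw [if_pos hc, if_pos (conn_of_conn_psiTwo h hc)]
    · rw [if_neg hc]
      split_ifs <;> norm_num
  have h2 : (if Conn ends (OneColourSwitch.compl ω) p q then (1 : ℤ) else 0) ≤
      (if Conn ends (OneColourSwitch.compl (psiTwo ends r s d ω)) p q then 1 else 0) := by
    by_cases hc : Conn ends (OneColourSwitch.compl ω) p q
    · rw [if_pos hc, if_pos (conn_compl_psiTwo_of_conn_compl h hc)]
    · rw [if_neg hc]
      split_ifs <;> norm_num
  linarith

end Sigma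

end NoPocket

end Summit.Ventures.PercRepro2
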